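import Summits.PneNP.PneNP.Theorems.KarlinRubinMonotoneBlindFormReduce

/-!
# Route KarlinRubin, crux `MonotoneBlind` (stmt-PneNP-18027): constant depth — locality of the reduction and a Fubini step

Stage C of the AC⁰ line (seat write-up `MonotoneBlind_AC0_announce.md`). The one-level reduction `swReduce V₁ x`
depends on `x` only through the slots NOT inside `V₁`, while the reduced formula reads only the slots inside `V₁`;
hence, conditioning on the outside part, the planted-minus-null count of the reduced formula is bounded by its worst
outside part (`exists_outside_max`), to which the induction hypothesis of the depth reduction applies.

* `swErase V₁ x` (whiten the inside of `V₁`), `swGlue V₁ x ξ` (`x` inside, `ξ` outside) and their slotwise values;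
* `swDnf_congr_outside`, `swReduce_congr_outside`, `swBadAt_congr_outside` — locality in the outside part;
* `swEval_congr_inside` — a formula inside `V` reads only the slots inside `V`;
* `card_fibre_mul_eq` — under the uniform measure the fibres of `swErase` have equal mass for inside events;
* `exists_outside_max` — **Fubini/maximum**: `Σ_A #{x : G(x_out) ∧ P(x_out, A, x_in)}` is `0` or at most
  `Σ_A #{x : P(ξ, A, x_in)}` for some outside part `ξ` with `G ξ`.

All `--supports stmt-PneNP-18027`; no definitions (`swErase`, `swGlue` are in `…FormIterDefs`).
-/

set_option linter.dupNamespace false -- `Summit.PneNP.PneNP.…`: summit = sub-problem (D-0017)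

namespace Summit.PneNP.PneNP.Theorems

open Finset
open Literature.Computability.Complexity
open Literature.Probability.RandomGraphs.PlantedClique

variable {n : ℕ}

/-! ### Locality in the outside part -/

/-- The switched DNF depends on `x` only off the inside of `V₁`. [folklore] -/
theorem swDnf_congr_outside (V₁ : Finset (Fin n)) {x x' : EdgeVec n}
    (h : ∀ e : (⊤ : SimpleGraph (Fin n)).edgeSet, (¬ ∀ v ∈ (e : Sym2 (Fin n)), v ∈ V₁) → x e = x' e)
    (l : List (Finset (⊤ : SimpleGraph (Fin n)).edgeSet)) : swDnf V₁ x' l = swDnf V₁ x l := by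
  classical
  unfold swDnf
  have hrun : ∀ z, swRun V₁ x' z l ∅ = swRun V₁ x z l ∅ := fun z => swRun_congr_outside V₁ z h l ∅
  simp only [hrun]

/-- The reduced formula depends on `x` only off the inside of `V₁`. [folklore] -/
theorem swReduce_congr_outside (V₁ : Finset (Fin n)) {x x' : EdgeVec n}
    (h : ∀ e : (⊤ : SimpleGraph (Fin n)).edgeSet, (¬ ∀ v ∈ (e : Sym2 (Fin n)), v ∈ V₁) → x e = x' e) :
    ∀ (d : ℕ) (pol : Bool) (f : swForm n (d + 2)), swReduce V₁ x' d pol f = swReduce V₁ x d pol f := by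
  have h' : ∀ e : (⊤ : SimpleGraph (Fin n)).edgeSet, (¬ ∀ v ∈ (e : Sym2 (Fin n)), v ∈ V₁) →
      (fun e => !x e) e = (fun e => !x' e) e := fun e he => by simp [h e he]
  intro d
  induction d with
  | zero =>
    intro pol f
    cases pol
    · rw [swReduce_zero_false', swReduce_zero_false']
      simp only [swDnf_congr_outside V₁ h']
    · rw [swReduce_zero_true', swReduce_zero_true']
      simp only [swDnf_congr_outside V₁ h]
  | succ d ih =>
    intro pol f
    rw [swReduce_succ, swReduce_succ]
    simp only [ih]

/-- The bad event depends on `x` only off the inside of `V₁`. [folklore] -/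
theorem swBadAt_congr_outside (V₁ : Finset (Fin n)) {x x' : EdgeVec n} (v₀ d : ℕ) (pol : Bool) (f : swForm n (d + 1))
    (h : ∀ e : (⊤ : SimpleGraph (Fin n)).edgeSet, (¬ ∀ v ∈ (e : Sym2 (Fin n)), v ∈ V₁) → x e = x' e) :
    swBadAt V₁ x' v₀ d pol f ↔ swBadAt V₁ x v₀ d pol f := by
  have h' : ∀ e : (⊤ : SimpleGraph (Fin n)).edgeSet, (¬ ∀ v ∈ (e : Sym2 (Fin n)), v ∈ V₁) →
      (fun e => !x e) e = (fun e => !x' e) e := fun e he => by simp [h e he]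
  unfold swBadAt
  refine exists_congr fun p => and_congr_right fun _ => exists_congr fun z => ?_
  obtain ⟨q, l⟩ := p
  cases q
  · simp only [Bool.false_eq_true, if_false, swRun_congr_outside V₁ z h l ∅]
  · simp only [if_true, swRun_congr_outside V₁ z h' l ∅]

/-- **A formula inside `V` reads only the slots inside `V`.** [folklore] -/
theorem swEval_congr_inside (V : Finset (Fin n)) {w w' : EdgeVec n}
    (h : ∀ e : (⊤ : SimpleGraph (Fin n)).edgeSet, (∀ v ∈ (e : Sym2 (Fin n)), v ∈ V) → w e = w' e) :
    ∀ (d : ℕ) (pol : Bool) (f : swForm n d), swIn V d f → (swEval d pol f w ↔ swEval d pol f w') := by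
  intro d
  induction d with
  | zero =>
    intro pol f hf
    rw [swIn_zero] at hf
    cases pol
    · rw [swEval_zero_false, swEval_zero_false]
      exact forall₂_congr fun e he => by rw [h e (hf e he)]
    · rw [swEval_zero_true, swEval_zero_true]
      exact exists_congr fun e => and_congr_right fun he => by rw [h e (hf e he)]
  | succ d ih =>
    intro pol f hf
    rw [swIn_succ] at hf
    cases pol
    · rw [swEval_succ_false, swEval_succ_false]
      exact forall₂_congr fun g hg => ih true g (hf g hg)
    · rw [swEval_succ_true, swEval_succ_true]
      exact exists_congr fun g => and_congr_right fun hg => ih false g (hf g hg)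

/-! ### Equal fibres of the erasing map -/

open Classical in
/-- **Equal fibres.** For an event `Q` depending only on the slots inside `V₁` and an outside part `ξ` (white inside
`V₁`): `#{x : swErase x = ξ ∧ Q x} · #{outside parts} = #{x : Q x}`. [folklore] -/
theorem card_fibre_mul_eq (V₁ : Finset (Fin n)) (Q : EdgeVec n → Prop)
    (hQ : ∀ x x' : EdgeVec n, (∀ e : (⊤ : SimpleGraph (Fin n)).edgeSet, (∀ v ∈ (e : Sym2 (Fin n)), v ∈ V₁) → x e = x' e) →
      (Q x ↔ Q x'))
    (ξ : EdgeVec n) (hξ : ∀ e : (⊤ : SimpleGraph (Fin n)).edgeSet, (∀ v ∈ (e : Sym2 (Fin n)), v ∈ V₁) → ξ e = false) :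
    #(univ.filter fun x : EdgeVec n => swErase V₁ x = ξ ∧ Q x) *
        #(univ.filter fun ξ' : EdgeVec n => swErase V₁ ξ' = ξ') = #(univ.filter fun x : EdgeVec n => Q x) := by
  set Ξ := univ.filter fun ξ' : EdgeVec n => swErase V₁ ξ' = ξ' with hΞ
  -- fibrewise decomposition of `{Q}` over `swErase`
  have hmaps : ∀ x ∈ univ.filter (fun x : EdgeVec n => Q x), swErase V₁ x ∈ Ξ := by
    intro x _
    rw [hΞ, mem_filter, swErase_eq_self_iff]
    exact ⟨mem_univ _, fun e he => swErase_of_inside V₁ x he⟩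
  rw [card_eq_sum_card_fiberwise hmaps]
  -- every fibre has the size of the `ξ`-fibre (glue the outside part `ξ`)
  have hfib : ∀ ξ' ∈ Ξ, #((univ.filter fun x : EdgeVec n => Q x).filter fun x => swErase V₁ x = ξ') =
      #(univ.filter fun x : EdgeVec n => swErase V₁ x = ξ ∧ Q x) := by
    intro ξ' hξ'
    rw [hΞ, mem_filter, swErase_eq_self_iff] at hξ'
    refine card_bij (fun x _ => swGlue V₁ x ξ) (fun x hx => ?_) (fun x hx x' hx' hxx' => ?_) (fun y hy => ?_)
    · rw [mem_filter, mem_filter] at hx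
      rw [mem_filter]
      exact ⟨mem_univ _, swErase_swGlue V₁ x ξ hξ,
        (hQ _ x fun e he => swGlue_of_inside V₁ x ξ he).2 hx.1.2⟩
    · rw [mem_filter, mem_filter] at hx hx'
      funext e
      by_cases he : ∀ v ∈ (e : Sym2 (Fin n)), v ∈ V₁
      · have h1 := congr_fun hxx' e
        rwa [swGlue_of_inside V₁ x ξ he, swGlue_of_inside V₁ x' ξ he] at h1
      · have h2 := congr_fun hx.2 e
        have h3 := congr_fun hx'.2 e
        rw [swErase_of_not_inside V₁ _ he] at h2 h3
        rw [h2, h3]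
    · rw [mem_filter] at hy
      obtain ⟨-, hey, hQy⟩ := hy
      refine ⟨swGlue V₁ y ξ', ?_, ?_⟩
      · rw [mem_filter, mem_filter]
        exact ⟨⟨mem_univ _, (hQ _ y fun e he => swGlue_of_inside V₁ y ξ' he).2 hQy⟩,
          swErase_swGlue V₁ y ξ' hξ'.2⟩
      · funext e
        by_cases he : ∀ v ∈ (e : Sym2 (Fin n)), v ∈ V₁
        · rw [swGlue_of_inside V₁ _ ξ he, swGlue_of_inside V₁ y ξ' he]
        · rw [swGlue_of_not_inside V₁ _ ξ he, ← hey, swErase_of_not_inside V₁ y he]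
  rw [sum_congr rfl hfib, sum_const, smul_eq_mul, mul_comm]

open Classical in
/-- **Fubini / maximum over the outside part.** For any event `G` and events `P ξ A ·` depending only on the slots
inside `V₁`: the sum over `A ∈ 𝒜` of `#{x : G(swErase x) ∧ P(swErase x, A, x)}` vanishes, or is at most
`Σ_{A ∈ 𝒜} #{x : P(ξ, A, x)}` for some outside part `ξ` (white inside `V₁`) with `G ξ`. [folklore] -/
theorem exists_outside_max (V₁ : Finset (Fin n)) (𝒜 : Finset (Finset (Fin n))) (G : EdgeVec n → Prop)
    (P : EdgeVec n → Finset (Fin n) → EdgeVec n → Prop)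
    (hP : ∀ ξ A, ∀ x x' : EdgeVec n, (∀ e : (⊤ : SimpleGraph (Fin n)).edgeSet,
      (∀ v ∈ (e : Sym2 (Fin n)), v ∈ V₁) → x e = x' e) → (P ξ A x ↔ P ξ A x')) :
    (∑ A ∈ 𝒜, #(univ.filter fun x : EdgeVec n => G (swErase V₁ x) ∧ P (swErase V₁ x) A x) = 0) ∨
      ∃ ξ : EdgeVec n, G ξ ∧ (∀ e : (⊤ : SimpleGraph (Fin n)).edgeSet, (∀ v ∈ (e : Sym2 (Fin n)), v ∈ V₁) → ξ e = false) ∧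
        ∑ A ∈ 𝒜, #(univ.filter fun x : EdgeVec n => G (swErase V₁ x) ∧ P (swErase V₁ x) A x) ≤
          ∑ A ∈ 𝒜, #(univ.filter fun x : EdgeVec n => P ξ A x) := by
  set Ξ := univ.filter fun ξ' : EdgeVec n => swErase V₁ ξ' = ξ' with hΞ
  set φ : EdgeVec n → ℕ := fun ξ => ∑ A ∈ 𝒜, #(univ.filter fun x : EdgeVec n => P ξ A x) with hφ
  by_cases hG : (Ξ.filter fun ξ => G ξ).Nonempty
  swap
  · -- no good outside part: the sum vanishes
    left
    refine sum_eq_zero fun A _ => card_eq_zero.2 (filter_eq_empty_iff.2 fun x _ hx => hG ⟨swErase V₁ x, ?_⟩)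
    rw [mem_filter, hΞ, mem_filter, swErase_eq_self_iff]
    exact ⟨⟨mem_univ _, fun e he => swErase_of_inside V₁ x he⟩, hx.1⟩
  right
  obtain ⟨ξ₀, hξ₀, hmax⟩ := exists_max_image (Ξ.filter fun ξ => G ξ) φ hG
  rw [mem_filter, hΞ, mem_filter, swErase_eq_self_iff] at hξ₀
  refine ⟨ξ₀, hξ₀.2, hξ₀.1.2, ?_⟩
  have hΞpos : 0 < #Ξ :=
    card_pos.2 ⟨ξ₀, by rw [hΞ, mem_filter, swErase_eq_self_iff]; exact hξ₀.1⟩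
  -- multiply by `#Ξ` and compare fibrewise
  refine Nat.le_of_mul_le_mul_right ?_ hΞpos
  calc (∑ A ∈ 𝒜, #(univ.filter fun x : EdgeVec n => G (swErase V₁ x) ∧ P (swErase V₁ x) A x)) * #Ξ
      = ∑ A ∈ 𝒜, ∑ ξ ∈ Ξ.filter (fun ξ => G ξ),
          #(univ.filter fun x : EdgeVec n => swErase V₁ x = ξ ∧ P ξ A x) * #Ξ := by
        rw [sum_mul]
        refine sum_congr rfl fun A _ => ?_
        rw [← sum_mul]
        congr 1
        have hmaps : ∀ x ∈ univ.filter (fun x : EdgeVec n => G (swErase V₁ x) ∧ P (swErase V₁ x) A x),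
            swErase V₁ x ∈ Ξ.filter fun ξ => G ξ := by
          intro x hx
          rw [mem_filter] at hx
          rw [mem_filter, hΞ, mem_filter, swErase_eq_self_iff]
          exact ⟨⟨mem_univ _, fun e he => swErase_of_inside V₁ x he⟩, hx.2.1⟩
        rw [card_eq_sum_card_fiberwise hmaps]
        refine sum_congr rfl fun ξ hξ => ?_
        congr 1
        ext x
        simp only [mem_filter, mem_univ, true_and]
        constructor
        · rintro ⟨⟨-, hPx⟩, hex⟩; exact ⟨hex, hex ▸ hPx⟩
        · rintro ⟨hex, hPx⟩
          rw [mem_filter] at hξ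
          exact ⟨⟨hex.symm ▸ hξ.2, hex.symm ▸ hPx⟩, hex⟩
    _ = ∑ ξ ∈ Ξ.filter (fun ξ => G ξ), ∑ A ∈ 𝒜, #(univ.filter fun x : EdgeVec n => P ξ A x) := by
        rw [sum_comm]
        refine sum_congr rfl fun ξ hξ => sum_congr rfl fun A _ => ?_
        rw [mem_filter, hΞ, mem_filter, swErase_eq_self_iff] at hξ
        exact card_fibre_mul_eq V₁ (P ξ A) (hP ξ A) ξ hξ.1.2
    _ ≤ ∑ _ξ ∈ Ξ.filter (fun ξ => G ξ), φ ξ₀ := sum_le_sum fun ξ hξ => hmax ξ hξ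
    _ = #(Ξ.filter fun ξ => G ξ) * φ ξ₀ := by rw [sum_const, smul_eq_mul]
    _ ≤ #Ξ * φ ξ₀ := Nat.mul_le_mul_right _ (card_filter_le _ _)
    _ = φ ξ₀ * #Ξ := mul_comm _ _

/-- Registered stub `stub_formFubini` of the AC⁰ line, stage C (side result of stmt-PneNP-18027, seat 0). [folklore] -/
theorem stub_formFubini : ∀ (s : Finset ℕ) (f : ℕ → ℕ) (c : ℕ), (∀ x ∈ s, f x ≤ c) → s.sum f ≤ s.card * c := by
  intro s f c h
  simpa [smul_eq_mul] using Finset.sum_le_card_nsmul s f c h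

end Summit.PneNP.PneNP.Theorems
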